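import Summits.BirchSwinnertonDyer.BirchSwinnertonDyer.Theorems.BiquadraticEisensteinDescentManinDatumSupercuspidalCMInertFormalChord
import Literature.NumberTheory.DiophantineGeometry.SIntegersFiniteExtension
import HarnessLib

set_option linter.dupNamespace false -- `Summit.BirchSwinnertonDyer.BirchSwinnertonDyer.Theorems.…` (summit = sub, D-0017)
set_option autoImplicit false

/-!
# Crux `ManinDatumSupercuspidalCMInert` (stmt-BirchSwinnertonDyer-20111, BED r605), CM side of H₇ — end of step (b) of memo
# PLAIN-ODD-57 §5: prime-to-`7` torsion classes of `y² = x³ − x` stay SEPARATED modulo every place above `7`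
# (`v(X_w − X_u) = 1`), without formal groups

Route `BiquadraticEisensteinDescent` (cell `pub/bsd-wall`, width seat `bsd-wall-cm-bed-w4` g10, RESOLVENT LANE; `--supports`
stmt-BirchSwinnertonDyer-20111, helper). THEOREMS ONLY (no definition, no named fact, no `sorry`); nothing is closed by this file and BSD is not
proved by any of it. Sequel to `…FormalChord`: there the chord abscissa `X(P_w + Q_t)` was shown `7`-integral and `≡ X(P_w)`, and
`chord_formal_sub_unit` turns the denominators `X(P_w+Q_t) − X(v)` of the smoothed Eisenstein value into units AS SOON AS `v(X(P_w) − X(v)) = 1`.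
This file supplies that last hypothesis — the classical «reduction is injective on prime-to-`p` torsion» — by valuation algebra only:

* `val_Y_lt_one_of_chords` — on any model in a valued field with `v 2 = 1`: if two integral points `P ≠ ±u` with `v(X_P − X_u) < 1` have
  integral chords `X(P ± u)`, then `v(Y_u) < 1` (both slopes `(Y_P ∓ Y_u)/(X_P − X_u)` are integral);
* `val_doubling_gt_one` — on `y² = x³ − x`: an integral point with `v(Y) < 1`, `Y ≠ 0` has doubling abscissa `(X² + 1)²/(4Y²)` of valuation
  `> 1` (`X ≡ 0, ±1`, so `X² + 1` is a unit as `v 2 = 1`) — impossible for a torsion point of order prime to `7`;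
* `normalizedX_two_mul` — the duplication formula of the tree (`PeriodPair.weierstrassP_two_mul_holds`, `deriv_derivWeierstrassP`) in the
  normalised coordinates of `y² = x³ − x`: `X(2w) = (X_w² + 1)²/(4Y_w²)`;
* ★ `val_sub_normalizedX_eq_one` — for `w` of order prime to `7`, `u` of ODD order prime to `7`, `w ± u ∉ Λ`, and EVERY valuation `v` of `ℂ`
  with `v 7 < 1`: `v(X_w − X_u) = 1`.

With `…FormalChord.chord_formal_sub_unit` this completes memo §5 (b): the smoothed value `−½·Y(P_w+Q_t)·Σ_{v ∈ E[α]∖0} (X(P_w+Q_t) − X_v)⁻¹`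
(`α` of odd norm prime to `7M′`) is `7`-integral. Remaining for H₇: step (d) (Galois/inertia on the `7`-division values) only.
References: [SilvermanAEC2009] VII.3.1 (b) (the statement; here proved ad hoc for `y² = x³ − x`), III.2.3 (group law);
[ArmitageEberlein2001] §7.4.2 (duplication formula).
-/

noncomputable section

open Polynomial Complex

namespace Summit.BirchSwinnertonDyer.BirchSwinnertonDyer.Theorems.BiquadraticEisensteinDescentManinDatumSupercuspidalCMInertTorsionSeparation

open Summit.BirchSwinnertonDyer.BirchSwinnertonDyer.Theorems.BiquadraticEisensteinDescentManinDatumSupercuspidalCMInertFormalChord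
  (val_natCast_eq_one_of_coprime_seven val_normalized_le_one_of_torsion normalizedX_add)

/-! ## §1 Valued-field algebra -/

section Valued

variable {F Γ₀ : Type*} [Field F] [LinearOrderedCommGroupWithZero Γ₀] (v : Valuation F Γ₀)

/-- **Two congruent integral points with integral chords have `Y ≡ 0`.** In a valued field with `v 2 = 1`: if `v X_P, v Y_P, v X_u, v Y_u ≤ 1`,
`X_P ≠ X_u`, `v(X_P − X_u) < 1`, and both `((Y_P − Y_u)/(X_P − X_u))² − X_P − X_u` and `((Y_P + Y_u)/(X_P − X_u))² − X_P − X_u` (the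
abscissae of `P + u` and `P − u`) are integral, then `v Y_u < 1` (and symmetrically `v Y_P < 1`). [cite: SilvermanAEC2009, III.2.3] -/
theorem val_Y_lt_one_of_chords (h2 : v 2 = 1) {XP YP Xu Yu : F} (hXP : v XP ≤ 1) (hXu : v Xu ≤ 1)
    (hne : XP ≠ Xu) (hlt : v (XP - Xu) < 1)
    (hplus : v (((YP - Yu) / (XP - Xu)) ^ 2 - XP - Xu) ≤ 1)
    (hminus : v (((YP + Yu) / (XP - Xu)) ^ 2 - XP - Xu) ≤ 1) : v Yu < 1 := by
  have hD0 : XP - Xu ≠ 0 := sub_ne_zero.mpr hne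
  -- both slopes are integral
  have hslope : ∀ Z : F, v ((Z / (XP - Xu)) ^ 2 - XP - Xu) ≤ 1 → v Z < 1 := by
    intro Z hZ
    have hsq : v ((Z / (XP - Xu)) ^ 2) ≤ 1 := by
      have : (Z / (XP - Xu)) ^ 2 = ((Z / (XP - Xu)) ^ 2 - XP - Xu) + XP + Xu := by ring
      rw [this]
      exact Valuation.map_add_le v (Valuation.map_add_le v hZ hXP) hXu
    have hl : v (Z / (XP - Xu)) ≤ 1 := Literature.NumberTheory.DiophantineGeometry.valuation_le_one_of_sq v hsq
    have : Z = Z / (XP - Xu) * (XP - Xu) := (div_mul_cancel₀ Z hD0).symm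
    rw [this, Valuation.map_mul]
    calc v (Z / (XP - Xu)) * v (XP - Xu) ≤ 1 * v (XP - Xu) := mul_le_mul' hl le_rfl
      _ = v (XP - Xu) := one_mul _
      _ < 1 := hlt
  have h₁ := hslope _ hplus
  have h₂ := hslope _ hminus
  have : Yu = ((YP + Yu) - (YP - Yu)) / 2 := by
    have h20 : (2 : F) ≠ 0 := fun h ↦ by rw [h, Valuation.map_zero] at h2; exact zero_ne_one h2
    field_simp; ring
  rw [this, map_div₀, h2, div_one]
  exact Valuation.map_sub_lt v h₂ h₁

/-- **Doubling a point with `Y ≡ 0` leaves the integral locus** (`y² = x³ − x`): if `v X ≤ 1`, `Y² = X³ − X`, `v Y < 1`, `Y ≠ 0` and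
`v 2 = 1`, then the doubling abscissa `(X² + 1)²/(4Y²)` has valuation `> 1` (`X(X−1)(X+1) ≡ 0` forces `X² + 1 ≡ 1` or `≡ 2`, a unit).
[cite: SilvermanAEC2009, III.2.3 (duplication formula)] -/
theorem val_doubling_gt_one (h2 : v 2 = 1) {X Y : F} (hX : v X ≤ 1) (hY : Y ^ 2 = X ^ 3 - X) (hvY : v Y < 1) (hY0 : Y ≠ 0) :
    1 < v ((X ^ 2 + 1) ^ 2 / (4 * Y ^ 2)) := by
  -- `X² + 1` is a unit
  have hunit : v (X ^ 2 + 1) = 1 := by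
    have hprod : v X * v (X ^ 2 - 1) < 1 := by
      rw [← Valuation.map_mul, show X * (X ^ 2 - 1) = X ^ 3 - X by ring, ← hY, Valuation.map_pow]
      exact pow_lt_one₀ zero_le hvY two_ne_zero
    by_cases hx : v X < 1
    · rw [add_comm]
      refine Valuation.map_one_add_of_lt v ?_
      rw [Valuation.map_pow]; exact pow_lt_one₀ zero_le hx two_ne_zero
    · push Not at hx
      have hx1 : v X = 1 := le_antisymm hX hx
      rw [hx1, one_mul] at hprod
      have : X ^ 2 + 1 = 2 + (X ^ 2 - 1) := by ring
      rw [this, Valuation.map_add_eq_of_lt_left v (by rw [h2]; exact hprod), h2]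
  have h4 : v (4 : F) = 1 := by rw [show (4 : F) = 2 ^ 2 by norm_num, Valuation.map_pow, h2, one_pow]
  have hvY0 : 0 < v Y := lt_of_le_of_ne zero_le (Ne.symm ((Valuation.ne_zero_iff v).mpr hY0))
  rw [map_div₀, Valuation.map_pow, hunit, one_pow, Valuation.map_mul, h4, one_mul, Valuation.map_pow, one_div]
  exact (one_lt_inv₀ (pow_pos hvY0 2)).mpr (pow_lt_one₀ zero_le hvY two_ne_zero)

end Valued

/-! ## §2 The Gaussian lattice: duplication in normalised coordinates and separation of prime-to-`7` torsion -/

section Analytic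

open scoped PeriodPair
open PeriodPair Literature.NumberTheory.EllipticCurves Literature.NumberTheory.EllipticCurves.GaussianLattice

/-- **The duplication formula in normalised coordinates** (`y² = x³ − x`, `X = ℘/ϖ₀²`, `Y = ℘′/(2ϖ₀³)`): for `w, 2w ∉ Λ = ℤi + ℤ`,
`X(2w) = (X_w² + 1)²/(4Y_w²)` (tree `PeriodPair.weierstrassP_two_mul_holds` with `℘″ = 6℘² − g₂/2`, `g₂ = 4ϖ₀⁴`, `℘′² = 4℘³ − g₂℘`).
[cite: ArmitageEberlein2001, §7.4.2 (Corollary: duplication formula)] -/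
theorem normalizedX_two_mul {w : ℂ} (hw : w ∉ (ofUpperHalfPlane UpperHalfPlane.I).lattice)
    (h2w : 2 * w ∉ (ofUpperHalfPlane UpperHalfPlane.I).lattice) :
    ℘[ofUpperHalfPlane UpperHalfPlane.I] (2 * w) / ((Real.Gamma (1 / 4) ^ 2 / (2 * Real.sqrt (2 * Real.pi)) : ℝ) : ℂ) ^ 2 =
      ((℘[ofUpperHalfPlane UpperHalfPlane.I] w / ((Real.Gamma (1 / 4) ^ 2 / (2 * Real.sqrt (2 * Real.pi)) : ℝ) : ℂ) ^ 2) ^ 2 + 1) ^ 2 /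
        (4 * (℘'[ofUpperHalfPlane UpperHalfPlane.I] w / (2 * ((Real.Gamma (1 / 4) ^ 2 / (2 * Real.sqrt (2 * Real.pi)) : ℝ) : ℂ) ^ 3)) ^ 2) := by
  set L : PeriodPair := ofUpperHalfPlane UpperHalfPlane.I with hL
  set ϖ : ℂ := ((Real.Gamma (1 / 4) ^ 2 / (2 * Real.sqrt (2 * Real.pi)) : ℝ) : ℂ) with hϖ
  have hϖ0 : ϖ ≠ 0 := Complex.ofReal_ne_zero.mpr varpi_pos.ne'
  have hD : ℘'[L] w ≠ 0 := fun h0 ↦ h2w (L.two_mul_mem_lattice_of_derivWeierstrassP_eq_zero hw h0)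
  have hdup := weierstrassP_two_mul_holds (L := L) w hw hD
  have hsq := L.derivWeierstrassP_sq w hw
  rw [L.deriv_derivWeierstrassP hw] at hdup
  rw [hL, g₂_eq_varpi', g₃_ofUpperHalfPlane_I, sub_zero, ← hϖ] at hsq
  rw [hL, g₂_eq_varpi', ← hϖ] at hdup
  rw [← hL] at hsq hdup
  rw [hdup]
  have h4 : (4 : ℂ) ≠ 0 := by norm_num
  field_simp
  linear_combination (-32 * ℘[L] w) * hsq

/-- ★ **Prime-to-`7` torsion classes stay separated at every place above `7`.** Let `w ∉ Λ` with `m w ∈ Λ`, `7 ∤ m`, and `u ∉ Λ` with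
`n u ∈ Λ`, `n` odd, `7 ∤ n`, and `w + u, w − u ∉ Λ`. Then for EVERY valuation `v` of `ℂ` with `v 7 < 1`, in the normalised coordinates of
`y² = x³ − x`: `v(X_w − X_u) = 1`. (If `v(X_w − X_u) < 1`: the chords `X(w ± u)` are integral torsion abscissae, so `v(Y_u) < 1` by
`val_Y_lt_one_of_chords`; but `2u` is again torsion of order prime to `7`, so `X(2u) = (X_u² + 1)²/(4Y_u²)` is integral, contradicting
`val_doubling_gt_one`.) [cite: SilvermanAEC2009, VII.3.1 (b)] -/
theorem val_sub_normalizedX_eq_one {Γ₀ : Type*} [LinearOrderedCommGroupWithZero Γ₀] (v : Valuation ℂ Γ₀) (h7 : v 7 < 1)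
    {w u : ℂ} {m n : ℕ} (hw : w ∉ (ofUpperHalfPlane UpperHalfPlane.I).lattice)
    (hmw : ((m : ℂ) * w) ∈ (ofUpperHalfPlane UpperHalfPlane.I).lattice) (hm7 : Nat.Coprime m 7)
    (hu : u ∉ (ofUpperHalfPlane UpperHalfPlane.I).lattice)
    (hnu : ((n : ℂ) * u) ∈ (ofUpperHalfPlane UpperHalfPlane.I).lattice) (hn7 : Nat.Coprime n 7) (hnodd : Odd n)
    (hadd : w + u ∉ (ofUpperHalfPlane UpperHalfPlane.I).lattice) (hsub : w - u ∉ (ofUpperHalfPlane UpperHalfPlane.I).lattice) :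
    v (℘[ofUpperHalfPlane UpperHalfPlane.I] w / ((Real.Gamma (1 / 4) ^ 2 / (2 * Real.sqrt (2 * Real.pi)) : ℝ) : ℂ) ^ 2 -
        ℘[ofUpperHalfPlane UpperHalfPlane.I] u / ((Real.Gamma (1 / 4) ^ 2 / (2 * Real.sqrt (2 * Real.pi)) : ℝ) : ℂ) ^ 2) = 1 := by
  set L : PeriodPair := ofUpperHalfPlane UpperHalfPlane.I with hL
  -- facts about the points (before naming coordinates)
  obtain ⟨hXw, hYw⟩ := val_normalized_le_one_of_torsion v h7 hw hmw hm7
  obtain ⟨hXu, hYu⟩ := val_normalized_le_one_of_torsion v h7 hu hnu hn7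
  -- `w ± u` are torsion of order dividing `m n`, prime to `7`
  have hmn7 : Nat.Coprime (m * n) 7 := Nat.coprime_mul_iff_left.mpr ⟨hm7, hn7⟩
  have hmnadd : (((m * n : ℕ)) : ℂ) * (w + u) ∈ L.lattice := by
    have : (((m * n : ℕ)) : ℂ) * (w + u) = (n : ℂ) * ((m : ℂ) * w) + (m : ℂ) * ((n : ℂ) * u) := by push_cast; ring
    rw [this]
    exact add_mem (by simpa [zsmul_eq_mul] using L.lattice.smul_mem (n : ℤ) hmw)
      (by simpa [zsmul_eq_mul] using L.lattice.smul_mem (m : ℤ) hnu)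
  have hmnsub : (((m * n : ℕ)) : ℂ) * (w - u) ∈ L.lattice := by
    have : (((m * n : ℕ)) : ℂ) * (w - u) = (n : ℂ) * ((m : ℂ) * w) - (m : ℂ) * ((n : ℂ) * u) := by push_cast; ring
    rw [this]
    exact sub_mem (by simpa [zsmul_eq_mul] using L.lattice.smul_mem (n : ℤ) hmw)
      (by simpa [zsmul_eq_mul] using L.lattice.smul_mem (m : ℤ) hnu)
  obtain ⟨hXadd, -⟩ := val_normalized_le_one_of_torsion v h7 hadd hmnadd hmn7
  obtain ⟨hXsub, -⟩ := val_normalized_le_one_of_torsion v h7 hsub hmnsub hmn7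
  -- `2u ∉ Λ` (n odd), `n (2u) ∈ Λ`
  have h2u : 2 * u ∉ L.lattice := by
    intro h2
    obtain ⟨k, hk⟩ := hnodd
    apply hu
    have : u = (n : ℂ) * u - (k : ℂ) * (2 * u) := by rw [hk]; push_cast; ring
    rw [this]
    exact sub_mem hnu (by simpa [zsmul_eq_mul] using L.lattice.smul_mem (k : ℤ) h2)
  have hn2u : (n : ℂ) * (2 * u) ∈ L.lattice := by
    rw [show (n : ℂ) * (2 * u) = 2 * ((n : ℂ) * u) by ring]
    simpa [zsmul_eq_mul] using L.lattice.smul_mem (2 : ℤ) hnu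
  obtain ⟨hX2u, -⟩ := val_normalized_le_one_of_torsion v h7 h2u hn2u hn7
  have hdouble := normalizedX_two_mul hu h2u
  -- `℘ w ≠ ℘ u`
  have hne : ℘[L] w ≠ ℘[L] u := by
    intro h
    rcases (weierstrassP_eq_weierstrassP_iff (L := L) hw hu).mp h with h' | h'
    · exact hadd h'
    · exact hsub h'
  have hneg : -u ∉ L.lattice := fun h ↦ hu (by simpa using L.lattice.neg_mem h)
  have hne' : ℘[L] w ≠ ℘[L] (-u) := by rw [weierstrassP_neg]; exact hne
  have hchordP := normalizedX_add hw hu hne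
  have hchordM := normalizedX_add hw hneg hne'
  rw [weierstrassP_neg, derivWeierstrassP_neg, ← sub_eq_add_neg] at hchordM
  -- the curve equation at `u`
  set ϖ : ℂ := ((Real.Gamma (1 / 4) ^ 2 / (2 * Real.sqrt (2 * Real.pi)) : ℝ) : ℂ) with hϖ
  have hϖ0 : ϖ ≠ 0 := Complex.ofReal_ne_zero.mpr varpi_pos.ne'
  have hQ := L.derivWeierstrassP_sq u hu
  rw [hL, g₂_eq_varpi', g₃_ofUpperHalfPlane_I, sub_zero, ← hϖ, ← hL] at hQ
  set Xw : ℂ := ℘[L] w / ϖ ^ 2 with hXwdef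
  set Yw : ℂ := ℘'[L] w / (2 * ϖ ^ 3) with hYwdef
  set Xu : ℂ := ℘[L] u / ϖ ^ 2 with hXudef
  set Yu : ℂ := ℘'[L] u / (2 * ϖ ^ 3) with hYudef
  have hYu2 : Yu ^ 2 = Xu ^ 3 - Xu := by
    rw [hYudef, hXudef]
    field_simp
    linear_combination hQ
  have h2v : v (2 : ℂ) = 1 := by exact_mod_cast val_natCast_eq_one_of_coprime_seven v h7 (show Nat.Coprime 2 7 by norm_num)
  have hneX : Xw ≠ Xu := by
    intro h
    apply hne
    have := congrArg (· * ϖ ^ 2) h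
    simp only [hXwdef, hXudef, div_mul_cancel₀ _ (pow_ne_zero 2 hϖ0)] at this
    exact this
  -- suppose `v (Xw − Xu) < 1`
  refine le_antisymm (Valuation.map_sub_le v hXw hXu) ?_
  by_contra hlt
  push Not at hlt
  -- chords `X(w ± u)` are integral and given by the chord formula
  have hplus : v (((Yw - Yu) / (Xw - Xu)) ^ 2 - Xw - Xu) ≤ 1 := by
    rw [hXwdef, hYwdef, hXudef, hYudef, ← hchordP]; exact hXadd
  have hminus : v (((Yw + Yu) / (Xw - Xu)) ^ 2 - Xw - Xu) ≤ 1 := by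
    have : (Yw + Yu) / (Xw - Xu) = (Yw - -Yu) / (Xw - Xu) := by rw [sub_neg_eq_add]
    rw [this, hXwdef, hYwdef, hXudef, hYudef]
    have h := hXsub
    rw [hchordM] at h
    convert h using 3
    ring
  have hvYu : v Yu < 1 := val_Y_lt_one_of_chords v h2v hXw hXu hneX hlt hplus hminus
  -- `Yu ≠ 0` since `2u ∉ Λ`
  have hYu0 : Yu ≠ 0 := by
    intro h0
    have : ℘'[L] u = 0 := by
      rw [hYudef] at h0
      rcases div_eq_zero_iff.mp h0 with h | h
      · exact h
      · exact absurd h (mul_ne_zero two_ne_zero (pow_ne_zero 3 hϖ0))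
    exact h2u (L.two_mul_mem_lattice_of_derivWeierstrassP_eq_zero hu this)
  have hgt := val_doubling_gt_one v h2v hXu hYu2 hvYu hYu0
  -- but `X(2u)` is integral
  rw [hXudef, hYudef, ← hdouble] at hgt
  exact absurd hX2u (not_le.mpr hgt)

end Analytic

end Summit.BirchSwinnertonDyer.BirchSwinnertonDyer.Theorems.BiquadraticEisensteinDescentManinDatumSupercuspidalCMInertTorsionSeparation

end
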